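import Mathlib
import Summits.HubbardSuperconductivity.HubbardSuperconductivity.Theorems.TwSourcedCondensation.Negative.SourceResponseStructure
import Summits.HubbardSuperconductivity.HubbardSuperconductivity.Theorems.VisonPairCost.Negative.GaugeStructure
import Summits.HubbardSuperconductivity.HubbardSuperconductivity.Theorems.ThermalWedgeTwApproximatingHamiltonianGauge

/-!
# The seed rotation identity: global `U(1)` × seed covariance of the `d`-wave seeded Hubbard torus

Support file for the crux `SeededBrokenRegimeBoseFermiPinned` (item `stmt-HubbardSuperconductivity-14047`,
route `AposterioriCapRg`), line `seed-strength-flow`, ingredient S6 (`stub_seedRotationIdentity`); sibling idea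
card `rotation-identity-goldstone-pin`, whose first lemma this is.

**Statement.** For the grand-canonical Hubbard torus `K₀ = hubbardTorusWith 2 L 1 U μ` seeded by an arbitrary
COMPLEX `d`-wave pair source, `K₀ − a O∥ − b O⊥` with `O∥ = Δ_d + Δ_dᴴ`, `O⊥ = i(Δ_dᴴ − Δ_d)`,
`Δ_d = pairField dWaveFormFactor L` (i.e. the source `z̄Δ_d + zΔ_dᴴ`, `z = a + ib`), the ground energy depends
on `|z| = √(a² + b²)` only:
`E₀(K₀ − aO∥ − bO⊥) = E₀(dWaveSourceTorus L U μ √(a²+b²))`.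

**Proof.** `aO∥ + bO⊥ = z̄Δ_d + zΔ_dᴴ` (`seedRot_complexSeed_eq`). The constant gauge rotation
`W = phaseGauge (e^{-i arg z/2})` is unitary, fixes `K₀` (particle-number conservation) and multiplies `Δ_d` by
`e^{i arg z}`, so `W (K₀ − z̄Δ_d − zΔ_dᴴ) Wᴴ = K₀ − |z|(Δ_d + Δ_dᴴ)`: this is the tree's
`twAhm_phaseGauge_conj_approx` (route `ThermalWedge`, Bogoliubov Jr. approximating Hamiltonian, amplitude `c = z`,
`a = 1`), giving `seedRot_phaseGauge_conj_complexSeed`; the ground energy is invariant under unitary conjugation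
(tree: `groundEnergy_unitary_conj'`, `twAhm_phaseGauge_const_mem_unitary`).

This is the source-folklore form of Goldstone's theorem at `q = 0` for the seeded torus: the second `b`-derivative
at `b = 0` identifies the transverse zero-momentum pair susceptibility with `ω_h(O∥)/(2h)` exactly, in finite
volume — the ingredient that pins the transverse mass at both seeds in the line's ANCHOR/STEP cut.

Sources: T. Koma, H. Tasaki, PRL 68 (1992) 3248, eqs. (5)–(8) (the gauge transformation); folklore.
Tree: `twAhm_*` gauge API (`Theorems/ThermalWedgeTwApproximatingHamiltonianGauge`), `phaseGauge`
(`Literature…MagneticHubbardTorus`, `…BdGBondHamiltonian`), `groundEnergy_unitary_conj'`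
(`Theorems/VisonPairCost/Negative/GaugeStructure`), `dWaveSourceTorus` (`Literature…DWaveSource`).
-/

set_option linter.dupNamespace false -- Summit.<S>.<S> doubles the summit name (tree convention)

namespace Summit.HubbardSuperconductivity.HubbardSuperconductivity.Theorems.AposterioriCapRgSeededBrokenRegimeBoseFermiPinned

open Matrix Finset Literature.MathematicalPhysics.QuantumLattice Literature.Probability.LatticeModels
open Summit.HubbardSuperconductivity.HubbardSuperconductivity.Theorems
open scoped ComplexConjugate ComplexOrder Matrix

section Rotation

variable (L : ℕ) [NeZero L]

/-- The two real seed directions assemble to one complex seed: `a(Δ + Δᴴ) + b·i(Δᴴ − Δ) = z̄Δ + zΔᴴ` with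
`z = a + ib`, for the pair field `Δ = pairField φ L` of any form factor, inside `K₀ − ⋯`. [folklore] -/
theorem seedRot_complexSeed_eq (t U μ a b : ℝ) (φ : Site 2 → ℝ) :
    hubbardTorusWith 2 L t U μ
        - (a : ℂ) • (pairField φ L + (pairField φ L)ᴴ)
        - (b : ℂ) • (Complex.I • ((pairField φ L)ᴴ - pairField φ L)) =
      hubbardTorusWith 2 L t U μ
        - (starRingEnd ℂ ((a : ℂ) + b * Complex.I) • pairField φ L
          + ((a : ℂ) + b * Complex.I) • (pairField φ L)ᴴ) := by
  have hc : starRingEnd ℂ ((a : ℂ) + b * Complex.I) = (a : ℂ) - b * Complex.I := by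
    simp only [map_add, map_mul, Complex.conj_ofReal, Complex.conj_I]; ring
  rw [hc]
  ext i j
  simp only [Matrix.sub_apply, Matrix.add_apply, Matrix.smul_apply, smul_eq_mul]
  ring

/-- **The complex-seeded torus is gauge-equivalent to the real-seeded one**: for `z = a + ib` and the constant
gauge rotation `W = phaseGauge (e^{-i arg z/2})`,
`W (K₀ − a(Δ_d + Δ_dᴴ) − b·i(Δ_dᴴ − Δ_d)) Wᴴ = K₀ − |z|(Δ_d + Δ_dᴴ) = dWaveSourceTorus L U μ √(a² + b²)`
(Koma–Tasaki's gauge transformation; tree `twAhm_phaseGauge_conj_approx` with amplitude `z`). [folklore] -/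
theorem seedRot_phaseGauge_conj_complexSeed (U μ a b : ℝ) :
    phaseGauge (fun _ : FermionTorus 2 L => Circle.exp (-(Complex.arg ((a : ℂ) + b * Complex.I)) / 2)) *
        (hubbardTorusWith 2 L 1 U μ
          - (a : ℂ) • (pairField dWaveFormFactor L + (pairField dWaveFormFactor L)ᴴ)
          - (b : ℂ) • (Complex.I • ((pairField dWaveFormFactor L)ᴴ - pairField dWaveFormFactor L))) *
        (phaseGauge (fun _ : FermionTorus 2 L =>
          Circle.exp (-(Complex.arg ((a : ℂ) + b * Complex.I)) / 2)))ᴴ =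
      dWaveSourceTorus L U μ (Real.sqrt (a ^ 2 + b ^ 2)) := by
  have key := twAhm_phaseGauge_conj_approx L 1 U μ 1 dWaveFormFactor ((a : ℂ) + b * Complex.I)
  rw [Complex.ofReal_one, one_smul, mul_one, Complex.norm_add_mul_I] at key
  rw [seedRot_complexSeed_eq, key, dWaveSourceTorus]

end Rotation

/-! ### S6: the seed rotation identity -/

/-- **S6 (`SeedRotationIdentity`), ingredient of line `seed-strength-flow`.** The ground energy of the Hubbard torus
seeded by an arbitrary complex `d`-wave pair source `z̄Δ_d + zΔ_dᴴ`, `z = a + ib`, i.e. of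
`K₀ − a(Δ_d + Δ_dᴴ) − b·i(Δ_dᴴ − Δ_d)`, equals that of the real-seeded torus `dWaveSourceTorus L U μ |z|`
(global `U(1)` × seed covariance: conjugate by the unitary constant gauge rotation `phaseGauge (e^{-i arg z/2})`,
`seedRot_phaseGauge_conj_complexSeed`, and use unitary invariance of the ground energy).
Source-folklore Goldstone theorem at `q = 0`. [folklore] -/
theorem stub_seedRotationIdentity :
    ∀ (L : ℕ) [NeZero L] (U μ a b : ℝ),
      Matrix.groundEnergy (hubbardTorusWith 2 L 1 U μ
          - (a : ℂ) • (pairField dWaveFormFactor L + (pairField dWaveFormFactor L)ᴴ)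
          - (b : ℂ) • (Complex.I • ((pairField dWaveFormFactor L)ᴴ - pairField dWaveFormFactor L)))
        = Matrix.groundEnergy (dWaveSourceTorus L U μ (Real.sqrt (a ^ 2 + b ^ 2))) := by
  intro L _ U μ a b
  rw [← seedRot_phaseGauge_conj_complexSeed L U μ a b]
  exact (VisonPairCost.Negative.groundEnergy_unitary_conj' _
    (twAhm_phaseGauge_const_mem_unitary L _)).symm

end Summit.HubbardSuperconductivity.HubbardSuperconductivity.Theorems.AposterioriCapRgSeededBrokenRegimeBoseFermiPinned
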